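import Summits.AtomisticToContinuum.HydrodynamicLimit.Theses.InformationPercolationEngine
import Summits.AtomisticToContinuum.HydrodynamicLimit.Theorems.InformationPercolationEngineKineticClosureBridge
import HarnessLib

/-!
# Stub `stub_bridge` of the line `Sketch` (crux `InformationPercolationEngine.ChaosClosesEuler`,
stmt-AtomisticToContinuum-15141; `--supports`)

WHAT. The last step of the line: the pathwise relative-energy dock outputs `L¹(dx)`-closeness in probability
("`N → ∞` at fixed `r`, then `r → 0`") of the three `r`-CONE-MOLLIFIED empirical fields (density, momentum, energy)
of the evolved hard-sphere configuration to the classical hard-sphere-Euler solution `(ρ, ρu, E)(t, ·)`, inside the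
packing-guarded frame of the crux's conclusion (`∃ η₀` first, continuous positive profiles, `∃ σ₀`, guarded classical
solution tied at `t = 0`). `stub_bridge` turns this into the conclusion itself: `χ`-tested convergence in probability
`TendstoHydroFieldsAt … t` at every `t ∈ [0, T)`.

PROOF IDEA. Momentum and energy: the landed bridge `KineticClosureBridge.tendstoHydroFieldsAt_of_mollified`
(mollification commutator paid by the velocity moment, uniformly tight kinetic energy per particle along the flow,
`σ ≤ 1/2`). Density (`tendsto_densityField_of_mollified` below, the missing scalar/mass-one twin of
`KineticClosureBridge.tendsto_momentumField_of_mollified`): the cone kernel is a probability density supported in the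
minimal-image `r`-ball, so `|∫χ dμ_w − ∫ χ ρ̄ʳ(w)| ≤ ω_χ(r)`
(`KineticClosureDensity.abs_empiricalDensityField_sub_integral_mul_mollDensity_le`), no velocity moment needed; and
`|∫ χ (ρ̄ʳ − ρ(t))| ≤ sup|χ| · ∫|ρ̄ʳ − ρ(t)|` (`KineticClosureBridge.abs_integral_mul_sub_le`). Frame plumbing: keep
`η₀`, answer with `min σ₀ (1/2)`, continuity of the slices `(ρ, u, θ)(t, ·)` from `IsHardSphereEulerSolution`
(`IsSmoothSpaceTimeOn.isSmooth_slice`). The inline kernel `bx y x = 3/(πr³)(1 − d(y,x)/r)₊` of the registered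
signature is definitionally `DensityCapNegative.cone r y x`.

REFERENCES. Spohn, *Large Scale Dynamics of Interacting Particles* (1991), Part I Ch. 3 (hydrodynamic fields tested
against continuous observables vs. block/mollified averages). No named fact is invoked; everything is proved from tree
lemmas. prover-line-stmt-AtomisticToContinuum-15141-0 (stub worker).
-/

noncomputable section

namespace Summit.AtomisticToContinuum.HydrodynamicLimit.Theorems.ChaosClosesEulerBridge

open scoped BigOperators Topology Classical MeasureTheory ENNReal InnerProductSpace
open Filter Set MeasureTheory
open Literature.MathematicalPhysics.KineticTheory
open Literature.Analysis.FluidPDE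
open Summit.AtomisticToContinuum.HydrodynamicLimit.Theorems.DensityCapNegative (cone mollDensity)
open Summit.AtomisticToContinuum.HydrodynamicLimit.Theorems.KineticClosureDensity
  (continuous_mollDensity exists_modulus_euclidDist abs_empiricalDensityField_sub_integral_mul_mollDensity_le)
open Summit.AtomisticToContinuum.HydrodynamicLimit.Theorems.KineticClosureBridge
  (exists_scale abs_integral_mul_sub_le tendstoHydroFieldsAt_of_mollified)

/-! ## §1 Density: mollified-field convergence ⟹ tested-field convergence -/

/-- **DENSITY: mollified-field convergence ⟹ tested-field convergence** (any laws of the form `localGibbsLaw`, any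
flow family, time `t`, continuous limit field `f`): `L¹(dx)`-convergence in probability ("`N → ∞` then `r → 0`") of
the `r`-mollified empirical density to `f` gives convergence in probability of the `χ`-tested empirical density to
`∫ χ f` for every continuous `χ`. Unlike momentum/energy no velocity moment enters: the cone has unit mass, so the
mollification commutator is bounded by the `r`-modulus of `χ` alone. [folklore] -/
theorem tendsto_densityField_of_mollified {σ : ℝ} {a₀ θ₀ : T3 → ℝ} {u₀ : T3 → V3}
    (Φ : (N : ℕ) → HardSphereFlow (Torus.geometry (Fin 3)) (hsDiameter σ N) (N + 1)) (t : ℝ)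
    {f : T3 → ℝ} (hf : Continuous f)
    (hM : ∀ η δ : ℝ, 0 < η → 0 < δ → ∃ r₀ : ℝ, 0 < r₀ ∧ ∀ r : ℝ, 0 < r → r < r₀ → ∃ N₀ : ℕ, ∀ N : ℕ, N₀ ≤ N →
      localGibbsLaw σ a₀ u₀ θ₀ N (Φ N)
        {z | η < ∫ x, |empiricalDensityField ((Φ N).flow t z) (fun y => cone r y x) - f x|} ≤ ENNReal.ofReal δ)
    (χ : T3 → ℝ) (hχ : Continuous χ) {δ : ℝ} (hδ : 0 < δ) :
    Tendsto (fun N => localGibbsLaw σ a₀ u₀ θ₀ N (Φ N)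
      {z | δ < |empiricalDensityField ((Φ N).flow t z) χ - ∫ x, χ x * f x|}) atTop (𝓝 0) := by
  obtain ⟨C, hC0, hC⟩ := exists_forall_abs_le_of_continuous hχ
  rw [ENNReal.tendsto_atTop_zero]
  intro ε hε
  obtain ⟨δ', hδ', hδ'ε⟩ : ∃ δ' : ℝ, 0 < δ' ∧ ENNReal.ofReal δ' ≤ ε := by
    rcases eq_or_ne ε ⊤ with h | h
    · exact ⟨1, one_pos, h ▸ le_top⟩
    · exact ⟨ε.toReal, ENNReal.toReal_pos hε.ne' h, (ENNReal.ofReal_toReal h).le⟩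
  obtain ⟨r₁, hr₁, hmod⟩ := exists_modulus_euclidDist hχ (show (0 : ℝ) < δ / 3 by positivity)
  set η : ℝ := δ / (3 * (C + 1)) with hη_def
  obtain ⟨r₀, hr₀, Hr⟩ := hM η δ' (by positivity) hδ'
  obtain ⟨r, hr, hrr₀, hrr₁, hr2⟩ := exists_scale hr₀ hr₁
  obtain ⟨N₀, HN⟩ := Hr r hr hrr₀
  refine ⟨N₀, fun N hN => (measure_mono ?_).trans ((HN N hN).trans hδ'ε)⟩
  -- the deviation event is contained in the `L¹`-deviation event of the mollified density
  intro z hz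
  by_contra hzc
  have hzL : ∫ x, |empiricalDensityField ((Φ N).flow t z) (fun y => cone r y x) - f x| ≤ η := not_lt.1 hzc
  set w := (Φ N).flow t z with hw
  have hmod' : ∀ x y, Torus.euclidDist x y < r → |χ x - χ y| ≤ δ / 3 := fun x y hxy =>
    hmod x y (hxy.trans_le hrr₁)
  -- (a) mollification error (unit cone mass; `mollDensity r w x` is `empiricalDensityField w (cone r · x)` by `rfl`)
  have ha' : |empiricalDensityField w χ - ∫ x, χ x * empiricalDensityField w (fun y => cone r y x)| ≤ δ / 3 :=
    abs_empiricalDensityField_sub_integral_mul_mollDensity_le hr hr2 hχ hmod' (Nat.succ_ne_zero N) w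
  -- (b) testing the `L¹`-small difference against the bounded `χ`
  have hb' : |(∫ x, χ x * empiricalDensityField w (fun y => cone r y x)) - ∫ x, χ x * f x| ≤ δ / 3 :=
    calc _ ≤ C * ∫ x, |empiricalDensityField w (fun y => cone r y x) - f x| :=
          abs_integral_mul_sub_le hχ hC (continuous_mollDensity r w) hf
      _ ≤ C * η := by gcongr
      _ ≤ δ / 3 := by
          rw [hη_def]
          rw [show C * (δ / (3 * (C + 1))) = (δ / 3) * (C / (C + 1)) by field_simp]
          exact mul_le_of_le_one_right (by positivity) ((div_le_one (by positivity)).2 (by linarith))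
  have htri : |empiricalDensityField w χ - ∫ x, χ x * f x| ≤ δ / 3 + δ / 3 :=
    (abs_sub_le _ _ _).trans (add_le_add ha' hb')
  exact absurd (hz : δ < |empiricalDensityField w χ - ∫ x, χ x * f x|) (not_lt.2 (htri.trans (by linarith)))

/-! ## §2 The stub: mollified closeness in the band ⟹ the crux's conclusion -/

/-- **`stub_bridge`** (line `Sketch`, crux `ChaosClosesEuler`, stmt-AtomisticToContinuum-15141). In the packing-guarded
frame of the crux's conclusion (`∃ η₀`, continuous positive profiles, `∃ σ₀`, guarded classical hard-sphere-Euler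
solution on `[0, T)` tied to the local Gibbs laws at `t = 0`), `L¹(dx)`-closeness in probability
("`N → ∞` at fixed `r`, then `r → 0`") of the three `r`-cone-mollified empirical fields to `(ρ, ρu, E)(t, ·)` at every
`t ∈ [0, T)` implies the `χ`-tested convergence in probability `TendstoHydroFieldsAt … t` at every `t ∈ [0, T)`.
Proof: keep `η₀`, cut `σ₀` at `1/2`, slices of the classical solution are continuous, density by
`tendsto_densityField_of_mollified`, momentum and energy by `KineticClosureBridge.tendstoHydroFieldsAt_of_mollified`.
[folklore] -/
theorem stub_bridge :
    (∃ η₀ : ℝ, 0 < η₀ ∧ ∀ (a₀ θ₀ : T3 → ℝ) (u₀ : T3 → V3), Continuous a₀ → Continuous θ₀ → Continuous u₀ →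
    (∀ x, 0 < a₀ x) → (∀ x, 0 < θ₀ x) → ∃ σ₀ : ℝ, 0 < σ₀ ∧ ∀ σ : ℝ, 0 < σ → σ < σ₀ →
    ∀ (T : ℝ) (ρ θ : ℝ → T3 → ℝ) (u : ℝ → T3 → V3), IsHardSphereEulerSolution σ T ρ u θ →
    (∀ t ∈ Set.Ico 0 T, ∀ x, ρ t x * σ ^ 3 < η₀) →
    ∀ Φ : (N : ℕ) → HardSphereFlow (Torus.geometry (Fin 3)) (hsDiameter σ N) (N + 1),
    TendstoHydroFieldsAt (fun N => localGibbsLaw σ a₀ u₀ θ₀ N (Φ N)) Φ ρ u θ 0 →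
    ∀ t ∈ Set.Ico 0 T, ∀ η δ : ℝ, 0 < η → 0 < δ →
    ∃ r₀ : ℝ, 0 < r₀ ∧ ∀ r : ℝ, 0 < r → r < r₀ → ∃ N₀ : ℕ, ∀ N : ℕ, N₀ ≤ N →
    let bx : T3 → T3 → ℝ := fun y x => 3 / (Real.pi * r ^ 3) * max (1 - Torus.euclidDist y x / r) 0
    localGibbsLaw σ a₀ u₀ θ₀ N (Φ N)
        {z | η < ∫ x, |empiricalDensityField ((Φ N).flow t z) (fun y => bx y x) - ρ t x|} ≤ ENNReal.ofReal δ ∧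
    localGibbsLaw σ a₀ u₀ θ₀ N (Φ N)
        {z | η < ∫ x, ‖empiricalMomentumField ((Φ N).flow t z) (fun y => bx y x) - ρ t x • u t x‖} ≤
          ENNReal.ofReal δ ∧
    localGibbsLaw σ a₀ u₀ θ₀ N (Φ N)
        {z | η < ∫ x, |empiricalEnergyField ((Φ N).flow t z) (fun y => bx y x) -
          totalEnergyDensity (ρ t x) (u t x) (θ t x)|} ≤ ENNReal.ofReal δ) →
    ∃ η₀ : ℝ, 0 < η₀ ∧ ∀ (a₀ θ₀ : T3 → ℝ) (u₀ : T3 → V3), Continuous a₀ → Continuous θ₀ → Continuous u₀ →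
    (∀ x, 0 < a₀ x) → (∀ x, 0 < θ₀ x) → ∃ σ₀ : ℝ, 0 < σ₀ ∧ ∀ σ : ℝ, 0 < σ → σ < σ₀ →
    ∀ (T : ℝ) (ρ θ : ℝ → T3 → ℝ) (u : ℝ → T3 → V3), IsHardSphereEulerSolution σ T ρ u θ →
    (∀ t ∈ Set.Ico 0 T, ∀ x, ρ t x * σ ^ 3 < η₀) →
    ∀ Φ : (N : ℕ) → HardSphereFlow (Torus.geometry (Fin 3)) (hsDiameter σ N) (N + 1),
    TendstoHydroFieldsAt (fun N => localGibbsLaw σ a₀ u₀ θ₀ N (Φ N)) Φ ρ u θ 0 →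
    ∀ t ∈ Set.Ico 0 T, TendstoHydroFieldsAt (fun N => localGibbsLaw σ a₀ u₀ θ₀ N (Φ N)) Φ ρ u θ t := by
  rintro ⟨η₀, hη₀, H⟩
  refine ⟨η₀, hη₀, fun a₀ θ₀ u₀ ha hθ hu ha0 hθ0 => ?_⟩
  obtain ⟨σ₀, hσ₀, Hσ⟩ := H a₀ θ₀ u₀ ha hθ hu ha0 hθ0
  refine ⟨min σ₀ (1 / 2), lt_min hσ₀ (by norm_num), fun σ hσ hσlt T ρ θ u hE hguard Φ hA t ht => ?_⟩
  have hσ₀' : σ < σ₀ := hσlt.trans_le (min_le_left _ _)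
  have hσ2 : σ ≤ 1 / 2 := (hσlt.trans_le (min_le_right _ _)).le
  -- the dock's output at this `σ`, solution, flow family, tie and time
  have HM := Hσ σ hσ hσ₀' T ρ θ u hE hguard Φ hA t ht
  -- continuity of the time-`t` slices of the classical solution
  have hρt : Continuous (ρ t) := (hE.smooth_density.isSmooth_slice ht).continuous
  have hut : Continuous (u t) := (hE.smooth_velocity.isSmooth_slice ht).continuous
  have hθt : Continuous (θ t) := (hE.smooth_temperature.isSmooth_slice ht).continuous
  refine tendstoHydroFieldsAt_of_mollified hσ2 ha hθ hu ha0 hθ0 Φ t hρt hut hθt ?_ ?_ ?_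
  · -- density: the first conjunct, through `tendsto_densityField_of_mollified`
    intro χ hχ δ hδ
    refine tendsto_densityField_of_mollified Φ t hρt (fun η δ' hη hδ' => ?_) χ hχ hδ
    obtain ⟨r₀, hr₀, Hr⟩ := HM η δ' hη hδ'
    refine ⟨r₀, hr₀, fun r hr hrr₀ => ?_⟩
    obtain ⟨N₀, HN⟩ := Hr r hr hrr₀
    exact ⟨N₀, fun N hN => (HN N hN).1⟩
  · -- momentum: the second conjunct
    intro η δ hη hδ
    obtain ⟨r₀, hr₀, Hr⟩ := HM η δ hη hδ
    refine ⟨r₀, hr₀, fun r hr hrr₀ => ?_⟩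
    obtain ⟨N₀, HN⟩ := Hr r hr hrr₀
    exact ⟨N₀, fun N hN => (HN N hN).2.1⟩
  · -- energy: the third conjunct
    intro η δ hη hδ
    obtain ⟨r₀, hr₀, Hr⟩ := HM η δ hη hδ
    refine ⟨r₀, hr₀, fun r hr hrr₀ => ?_⟩
    obtain ⟨N₀, HN⟩ := Hr r hr hrr₀
    exact ⟨N₀, fun N hN => (HN N hN).2.2⟩

end Summit.AtomisticToContinuum.HydrodynamicLimit.Theorems.ChaosClosesEulerBridge

end
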